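import Summits.Ventures.PercRepro.RankLevelSetRuleQSliceMomentBounds
import Summits.Ventures.PercRepro.RankLevelSetRuleQSliceBorderAll

/-!
# PercRepro — THE CLIMB FROM THE BORDERLINE TO THE FIRST UNTRUNCATED SLICE AT FIXED `q` (night-1, gen 22; dossier §33)

At a fixed `q = m + 1 + K` (`k = K + 2`) the borderline theorem `rhat_borderline_all` (the slice `u = k − 2` at `(q, m+1)`) is
lifted one slice up, to `(q, m)` (the slice `u = k − 1`):
* `mhat_eq_choose_of_le` — `m̂ = C(q+j+a, a+j)` on the untruncated swap classes (`j ≤ q − m'`);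
* **`mhat_border_bound`** — on the borderline the only truncated class is `j = K + 1`, and its truncation is priced:
  `(K+1)²·C(q+K+1+a, a+K+1) ≤ ((K+1)² + q)·m̂(q, m', a, K+1)` (the missing swaps `t_D = K+1` against the class `t_D = K`);
* **`rhat_border_le`** — `R̂(q, k, m+1) ≤ L(q, k, m+1) + (q/(K+1)²)·C(2K+2, K+1)·S_{K+1}(q, m+1)` (`L` the untruncated lower bound);
* **`first_untrunc_of_core`** — with the slice step `L(q, k, m) − L(q, k, m+1) = S_1(q, m) − C(2K+2, K+1)·S_{K+2}(q, m)`
  (`rhatSliceL_step`) and `rhatSliceL_le_rhat`, the CORE inequality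
  `C(2K+2, K+1)·[S_{K+2}(q, m) + (q/(K+1)²)·S_{K+1}(q, m+1)] ≤ S_1(q, m)` gives `Φ(q+k, q) ≤ R̂(q, k, m)`;
* **`core_of_fin`** — the moment bounds of RankLevelSetRuleQSliceMomentBounds reduce the core to ONE explicit inequality
  (FIN): `C(2K+2, K+1)·(1 + q/(K+1)²)/C(m+d+1, d) ≤ 1 − K·(2J_2(m))`, `d = ⌊K/2⌋`.
(FIN) is proved on `q ≥ k²` for every `k ≥ 11` in RankLevelSetRuleQSliceFirstUntruncLarge. Axioms: standard.
-/

namespace PercRepro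

open Finset

/-! ### §1 The truncated swap count at the borderline -/

/-- `m̂(q, m', a, j) = C(q+j+a, a+j)` whenever `j ≤ q − m'` (no truncation: `mhat_eq` + Vandermonde). -/
lemma mhat_eq_choose_of_le (q m' a j : ℕ) (h : j ≤ q - m') :
    mhat q m' a j = (q + j + a).choose (a + j) := by
  rw [mhat_eq, min_eq_left h, sum_choose_mul_choose_add (q + a) a j, show q + a + j = q + j + a by ring]

/-- **The truncated count at the borderline** (`q = m' + K`, `j = K + 1`): the missing swap class `t_D = K + 1` is at most
`q/(K+1)²` times the class `t_D = K`, hence `(K+1)²·C(q+K+1+a, a+K+1) ≤ ((K+1)² + q)·m̂(q, m', a, K+1)`. -/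
lemma mhat_border_bound (K m' a : ℕ) :
    (K + 1) ^ 2 * (m' + K + (K + 1) + a).choose (a + (K + 1))
      ≤ ((K + 1) ^ 2 + (m' + K)) * mhat (m' + K) m' a (K + 1) := by
  have hmin : min (K + 1) (m' + K - m') = K := by omega
  rw [mhat_eq, hmin]
  have hfull := sum_choose_mul_choose_add (m' + K + a) a (K + 1)
  rw [Finset.sum_range_succ, Nat.choose_self, one_mul] at hfull
  set S := ∑ t ∈ range (K + 1), (K + 1).choose t * (m' + K + a).choose (a + t) with hS
  have hterm : (K + 1) * (m' + K + a).choose (a + K) ≤ S := by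
    rw [hS, Finset.sum_range_succ, Nat.choose_succ_self_right]
    exact Nat.le_add_left _ _
  have hmiss : (K + 1) * (m' + K + a).choose (a + (K + 1)) ≤ (m' + K) * (m' + K + a).choose (a + K) := by
    have h := Nat.choose_succ_right_eq (m' + K + a) (a + K)
    rw [show m' + K + a - (a + K) = m' by omega] at h
    calc (K + 1) * (m' + K + a).choose (a + (K + 1))
        ≤ (a + K + 1) * (m' + K + a).choose (a + (K + 1)) := Nat.mul_le_mul_right _ (by omega)
      _ = (m' + K + a).choose (a + K) * m' := by
          rw [show a + (K + 1) = a + K + 1 by ring, mul_comm, h]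
      _ ≤ (m' + K) * (m' + K + a).choose (a + K) := by nlinarith
  have h1 : (m' + K + (K + 1) + a).choose (a + (K + 1)) = S + (m' + K + a).choose (a + (K + 1)) := by
    rw [show m' + K + (K + 1) + a = m' + K + a + (K + 1) by ring, ← hfull]
  have h2 : (K + 1) ^ 2 * (m' + K + a).choose (a + (K + 1)) ≤ (m' + K) * S := by
    calc (K + 1) ^ 2 * (m' + K + a).choose (a + (K + 1))
        = (K + 1) * ((K + 1) * (m' + K + a).choose (a + (K + 1))) := by ring
      _ ≤ (K + 1) * ((m' + K) * (m' + K + a).choose (a + K)) := Nat.mul_le_mul_left _ hmiss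
      _ = (m' + K) * ((K + 1) * (m' + K + a).choose (a + K)) := by ring
      _ ≤ (m' + K) * S := Nat.mul_le_mul_left _ hterm
  rw [h1]
  nlinarith [h2]

/-- **`R̂` at the borderline against the untruncated lower bound** (`q = m' + K`, `k = K + 2`):
`R̂(q, k, m') ≤ Σ_{0<j<k} C(2K+2, j)·S_j(q, m') + (q/(K+1)²)·C(2K+2, K+1)·S_{K+1}(q, m')`. -/
lemma rhat_border_le (K m' : ℕ) :
    rhat (m' + K) (K + 2) m'
      ≤ ∑ j ∈ Finset.Ioo 0 (K + 2), ((2 * K + 2).choose j : ℚ) * sliceS (m' + K) m' j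
        + ((m' : ℚ) + K) / ((K : ℚ) + 1) ^ 2 * ((2 * K + 2).choose (K + 1) : ℚ) * sliceS (m' + K) m' (K + 1) := by
  unfold rhat
  rw [show m' + K + (K + 2) - m' = 2 * K + 2 by omega, sum_Ioo_nat, sum_Ioo_nat,
    show K + 2 - (0 + 1) = K + 1 by omega,
    Finset.sum_range_succ (fun u => ∑ a ∈ range (m' + 1), ((m'.choose a * (2 * K + 2).choose (0 + 1 + u) : ℕ) : ℚ)
      / (mhat (m' + K) m' a (0 + 1 + u) : ℚ)) K,
    Finset.sum_range_succ (fun u => ((2 * K + 2).choose (0 + 1 + u) : ℚ) * sliceS (m' + K) m' (0 + 1 + u)) K]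
  have hlow : ∀ u ∈ range K,
      ∑ a ∈ range (m' + 1), ((m'.choose a * (2 * K + 2).choose (0 + 1 + u) : ℕ) : ℚ)
          / (mhat (m' + K) m' a (0 + 1 + u) : ℚ)
        = ((2 * K + 2).choose (0 + 1 + u) : ℚ) * sliceS (m' + K) m' (0 + 1 + u) := by
    intro u hu
    rw [Finset.mem_range] at hu
    unfold sliceS
    rw [Finset.mul_sum]
    refine Finset.sum_congr rfl (fun a _ => ?_)
    rw [mhat_eq_choose_of_le (m' + K) m' a (0 + 1 + u) (by omega)]
    push_cast
    ring
  rw [Finset.sum_congr rfl hlow]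
  have htop : ∑ a ∈ range (m' + 1), ((m'.choose a * (2 * K + 2).choose (0 + 1 + K) : ℕ) : ℚ)
          / (mhat (m' + K) m' a (0 + 1 + K) : ℚ)
        ≤ ((2 * K + 2).choose (0 + 1 + K) : ℚ) * sliceS (m' + K) m' (0 + 1 + K)
          + ((m' : ℚ) + K) / ((K : ℚ) + 1) ^ 2 * ((2 * K + 2).choose (K + 1) : ℚ) * sliceS (m' + K) m' (K + 1) := by
    rw [show 0 + 1 + K = K + 1 by ring]
    unfold sliceS
    rw [Finset.mul_sum, Finset.mul_sum, ← Finset.sum_add_distrib]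
    refine Finset.sum_le_sum (fun a _ => ?_)
    have hb := mhat_border_bound K m' a
    have hmpos : (0 : ℚ) < (mhat (m' + K) m' a (K + 1) : ℚ) := Nat.cast_pos.mpr (mhat_pos _ _ _ _)
    have hCpos : (0 : ℚ) < ((m' + K + (K + 1) + a).choose (a + (K + 1)) : ℚ) :=
      Nat.cast_pos.mpr (Nat.choose_pos (by omega))
    have hbq : ((K : ℚ) + 1) ^ 2 * ((m' + K + (K + 1) + a).choose (a + (K + 1)) : ℚ)
        ≤ (((K : ℚ) + 1) ^ 2 + ((m' : ℚ) + K)) * (mhat (m' + K) m' a (K + 1) : ℚ) := by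
      exact_mod_cast hb
    have hinv : 1 / (mhat (m' + K) m' a (K + 1) : ℚ)
        ≤ (((K : ℚ) + 1) ^ 2 + ((m' : ℚ) + K))
          / (((K : ℚ) + 1) ^ 2 * ((m' + K + (K + 1) + a).choose (a + (K + 1)) : ℚ)) := by
      rw [div_le_div_iff₀ hmpos (by positivity)]
      linarith [hbq]
    push_cast
    calc (m'.choose a : ℚ) * ((2 * K + 2).choose (K + 1) : ℚ) / (mhat (m' + K) m' a (K + 1) : ℚ)
        = (m'.choose a : ℚ) * ((2 * K + 2).choose (K + 1) : ℚ) * (1 / (mhat (m' + K) m' a (K + 1) : ℚ)) := by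
          ring
      _ ≤ (m'.choose a : ℚ) * ((2 * K + 2).choose (K + 1) : ℚ)
          * ((((K : ℚ) + 1) ^ 2 + ((m' : ℚ) + K))
            / (((K : ℚ) + 1) ^ 2 * ((m' + K + (K + 1) + a).choose (a + (K + 1)) : ℚ))) :=
          mul_le_mul_of_nonneg_left hinv (by positivity)
      _ = _ := by field_simp
  linarith [htop]

/-! ### §2 The climb -/

/-- **THE CLIMB FROM THE BORDERLINE** (`q = m + 1 + K`, `k = K + 2`, `K ≥ 3`): the CORE inequality
`C(2K+2, K+1)·S_{K+2}(q, m) + (q/(K+1)²)·C(2K+2, K+1)·S_{K+1}(q, m+1) ≤ S_1(q, m)` gives `Φ(q+k, q) ≤ R̂(q, k, m)`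
(the slice `u = k − 1`) from `rhat_borderline_all` at `(q, m+1)`, through `rhat_border_le`, `rhatSliceL_step` and
`rhatSliceL_le_rhat`. -/
theorem first_untrunc_of_core (K m : ℕ) (hK : 3 ≤ K)
    (hcore : ((2 * K + 2).choose (K + 1) : ℚ) * sliceS (m + 1 + K) m (K + 2)
        + ((m : ℚ) + 1 + K) / ((K : ℚ) + 1) ^ 2 * ((2 * K + 2).choose (K + 1) : ℚ) * sliceS (m + 1 + K) (m + 1) (K + 1)
      ≤ sliceS (m + 1 + K) m 1) :
    phiK (m + 1 + K + (K + 2)) (m + 1 + K) ≤ rhat (m + 1 + K) (K + 2) m := by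
  have h1 : phiK (m + 1 + K + (K + 2)) (m + 1 + K) ≤ rhat (m + 1 + K) (K + 2) (m + 1) := by
    have := rhat_borderline_all (K + 2) (m + 1 + K) (by omega) (by omega)
    rwa [show m + 1 + K - (K + 2 - 2) = m + 1 by omega] at this
  have h2 := rhat_border_le K (m + 1)
  push_cast at h2
  have h3 := rhatSliceL_step K (K + 2) m (by omega)
  rw [show m + 1 + K + (K + 2) - m = 2 * K + 3 by omega, show m + 1 + K + (K + 2) - (m + 1) = 2 * K + 2 by omega,
    show K + (K + 2) = 2 * K + 2 by ring, show K + 2 - 1 = K + 1 by omega] at h3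
  have h4 := rhatSliceL_le_rhat (m + 1 + K) (K + 2) m
  rw [show m + 1 + K + (K + 2) - m = 2 * K + 3 by omega] at h4
  have h3' : ∑ j ∈ Finset.Ioo 0 (K + 2), ((2 * K + 3).choose j : ℚ) * sliceS (m + 1 + K) m j
      - ∑ j ∈ Finset.Ioo 0 (K + 2), ((2 * K + 2).choose j : ℚ) * sliceS (m + 1 + K) (m + 1) j
      = sliceS (m + 1 + K) m 1 - ((2 * K + 2).choose (K + 1) : ℚ) * sliceS (m + 1 + K) m (K + 2) := h3
  have h4' : ∑ j ∈ Finset.Ioo 0 (K + 2), ((2 * K + 3).choose j : ℚ) * sliceS (m + 1 + K) m j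
      ≤ rhat (m + 1 + K) (K + 2) m := h4
  linarith [h1, h2, h3', h4', hcore]

/-- **THE CORE FROM THE MOMENT BOUNDS**: with `d = ⌊K/2⌋` and `q = m + 1 + K`, the explicit inequality (FIN)
`C(2K+2, K+1)·(1 + q/(K+1)²)/C(m+d+1, d) ≤ 1 − K·(2J_2(m))` implies the core inequality of `first_untrunc_of_core`
(`sliceS_one_ge` below, `sliceS_le_odd` above, `C(m+d+1, d) ≤ C(m+d+2, d)`). -/
lemma core_of_fin (K m : ℕ) (hK : 1 ≤ K)
    (hfin : ((2 * K + 2).choose (K + 1) : ℚ) * (1 + ((m : ℚ) + 1 + K) / ((K : ℚ) + 1) ^ 2)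
        / ((m + K / 2 + 1).choose (K / 2) : ℚ)
      ≤ 1 - (K : ℚ) * (2 * sliceS (m + 1) m 2)) :
    ((2 * K + 2).choose (K + 1) : ℚ) * sliceS (m + 1 + K) m (K + 2)
      + ((m : ℚ) + 1 + K) / ((K : ℚ) + 1) ^ 2 * ((2 * K + 2).choose (K + 1) : ℚ) * sliceS (m + 1 + K) (m + 1) (K + 1)
      ≤ sliceS (m + 1 + K) m 1 := by
  set d := K / 2 with hd
  have hlow := sliceS_one_ge m K
  have hup1 := sliceS_le_odd m (K + 2) d (show m + 1 ≤ m + 1 + K by omega) (by omega)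
  have hup2 := sliceS_le_odd (m + 1) (K + 1) d (show m + 1 + 1 ≤ m + 1 + K by omega) (by omega)
  have hA : (0 : ℚ) < ((m + d + 1).choose d : ℚ) := Nat.cast_pos.mpr (Nat.choose_pos (by omega))
  have hA' : ((m + d + 1).choose d : ℚ) ≤ ((m + 1 + d + 1).choose d : ℚ) := by
    exact_mod_cast Nat.choose_le_choose d (by omega)
  have hq : (0 : ℚ) < ((m + 1 + K : ℕ) : ℚ) := by positivity
  set x : ℚ := ((m + 1 + K : ℕ) : ℚ) / ((m : ℚ) + 1) with hx
  have hx0 : 0 < x := by positivity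
  have hup2' : sliceS (m + 1 + K) (m + 1) (K + 1) ≤ x * (1 / (2 * ((m + d + 1).choose d : ℚ))) := by
    refine hup2.trans ?_
    have e1 : ((m + 1 + K : ℕ) : ℚ) / (((m + 1 : ℕ) : ℚ) + 1) ≤ x := by
      rw [hx]
      apply div_le_div_of_nonneg_left (by positivity) (by positivity)
      push_cast; linarith
    have e2 : 1 / (2 * ((m + 1 + d + 1).choose d : ℚ)) ≤ 1 / (2 * ((m + d + 1).choose d : ℚ)) :=
      one_div_le_one_div_of_le (by positivity) (by linarith)
    exact mul_le_mul e1 e2 (by positivity) (by positivity)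
  have hC0 : (0 : ℚ) ≤ ((2 * K + 2).choose (K + 1) : ℚ) := by positivity
  have hg0 : (0 : ℚ) ≤ ((m : ℚ) + 1 + K) / ((K : ℚ) + 1) ^ 2 := by positivity
  have key : ((2 * K + 2).choose (K + 1) : ℚ) * (1 + ((m : ℚ) + 1 + K) / ((K : ℚ) + 1) ^ 2)
        / ((m + d + 1).choose d : ℚ) * (x / 2) ≤ sliceS (m + 1 + K) m 1 := by
    calc ((2 * K + 2).choose (K + 1) : ℚ) * (1 + ((m : ℚ) + 1 + K) / ((K : ℚ) + 1) ^ 2)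
          / ((m + d + 1).choose d : ℚ) * (x / 2)
        ≤ (1 - (K : ℚ) * (2 * sliceS (m + 1) m 2)) * (x / 2) :=
          mul_le_mul_of_nonneg_right hfin (by positivity)
      _ = ((m + 1 + K : ℕ) : ℚ) / (2 * ((m : ℚ) + 1)) * (1 - (K : ℚ) * (2 * sliceS (m + 1) m 2)) := by
          rw [hx]; field_simp
      _ ≤ sliceS (m + 1 + K) m 1 := hlow
  calc ((2 * K + 2).choose (K + 1) : ℚ) * sliceS (m + 1 + K) m (K + 2)
        + ((m : ℚ) + 1 + K) / ((K : ℚ) + 1) ^ 2 * ((2 * K + 2).choose (K + 1) : ℚ) * sliceS (m + 1 + K) (m + 1) (K + 1)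
      ≤ ((2 * K + 2).choose (K + 1) : ℚ) * (x * (1 / (2 * ((m + d + 1).choose d : ℚ))))
        + ((m : ℚ) + 1 + K) / ((K : ℚ) + 1) ^ 2 * ((2 * K + 2).choose (K + 1) : ℚ)
          * (x * (1 / (2 * ((m + d + 1).choose d : ℚ)))) := by
        gcongr
    _ = ((2 * K + 2).choose (K + 1) : ℚ) * (1 + ((m : ℚ) + 1 + K) / ((K : ℚ) + 1) ^ 2)
          / ((m + d + 1).choose d : ℚ) * (x / 2) := by
        field_simp
    _ ≤ sliceS (m + 1 + K) m 1 := key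

end PercRepro
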